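import Summits.AtomisticToContinuum.Crystallization.Theorems.ChessboardParticlePlanesPeriodicWindowsEnvelopeTail3

/-!
# Envelope numerics for `PeriodicWindows` (stmt-AtomisticToContinuum-3240), stub E2b — identification with the Barlow layer sums

For the inverse-power potential `Vₙ(r) = (r²)⁻¹ⁿ`, in-layer spacing `a = 1` and layer spacing `c > 0`
(`t = c²`), the layer sums of `BarlowStackingEnergy.lean` are pattern sums of `…EnvelopeDefs`:
`‖layerVec 1 c δ k i j‖² = Q_δ(i,j) + k² c²` (`δ ∈ {0,1}`), hence
`layerInteraction Vₙ 1 c δ k = envSum δ k true n (c²)` (`k ≥ 1`), `inLayerInteraction Vₙ 1 = envIn n`,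
`∑' k, layerInteraction Vₙ 1 c δ (k+3) = envSum δ 3 false n (c²)` (Fubini over `ℕ × ℤ²`, summability
from `…EnvelopeTail3`), and finally the ENVELOPE IDENTITIES
`2 e₀ + s J(2) + 2 ∑_{k≥3} J(k) = envU n (c²) s`, `2 e₀ + s J(2) = envL n (c²) s` (`n ≥ 3`).
[folklore]
-/

noncomputable section

namespace Summit.AtomisticToContinuum.Crystallization.Theorems.PeriodicWindowsSketch

open Finset Summit.AtomisticToContinuum.Crystallization.Theorems.ExcessDecayLiouvilleCoarseGrains
open Literature.MathematicalPhysics.StatisticalMechanics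

/-! ## The norms of the layer vectors -/

/-- `‖layerVec 1 c δ k i j‖² = (i + j/2 + δ/2)² + ¾ (j + δ/3)² + k² c²`. [folklore] -/
theorem env_norm_layerVec_sq (c : ℝ) (δ k i j : ℤ) :
    ‖layerVec 1 c δ k i j‖ ^ 2 = ((i : ℝ) + j / 2 + δ / 2) ^ 2 + 3 / 4 * ((j : ℝ) + δ / 3) ^ 2 + (k : ℝ) ^ 2 * c ^ 2 := by
  rw [norm_layerVec, Real.sq_sqrt (by positivity)]
  have h3 : Real.sqrt 3 ^ 2 = 3 := Real.sq_sqrt (by norm_num)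
  nlinarith [h3]

/-- For `δ = d ∈ {0,1}`: `‖layerVec 1 c d k i j‖² = Q_d(i,j) + k² c²`. [folklore] -/
theorem env_norm_layerVec_sq_eq {d : ℕ} (hd : d = 0 ∨ d = 1) (c : ℝ) (k i j : ℤ) :
    ‖layerVec 1 c (d : ℤ) k i j‖ ^ 2 = hcpSumQ ((d : ℤ), i, j) + (k : ℝ) ^ 2 * c ^ 2 := by
  rw [env_norm_layerVec_sq]
  rcases hd with rfl | rfl
  · rw [Nat.cast_zero, hcpSumQ_even (show Even (0 : ℤ) from ⟨0, rfl⟩)]; push_cast; ring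
  · rw [Nat.cast_one, hcpSumQ_odd (by decide)]; push_cast; ring

/-- The potential `Vₙ` on a layer vector: `Vₙ ‖layerVec 1 c d k i j‖ = ((Q_d + k²c²)⁻¹)ⁿ`. [folklore] -/
theorem env_V_layerVec (n : ℕ) {d : ℕ} (hd : d = 0 ∨ d = 1) (c : ℝ) (k i j : ℤ) :
    (fun r : ℝ => (r ^ 2)⁻¹ ^ n) ‖layerVec 1 c (d : ℤ) k i j‖ =
      ((hcpSumQ ((d : ℤ), i, j) + (k : ℝ) ^ 2 * c ^ 2)⁻¹) ^ n := by
  simp only [env_norm_layerVec_sq_eq hd]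

/-! ## One layer -/

/-- **A single layer is a one-layer pattern sum**: for `k ≥ 1`,
`layerInteraction Vₙ 1 c d k = envSum d k true n (c²)`. [folklore] -/
theorem env_layerInteraction_eq (n : ℕ) {d : ℕ} (hd : d = 0 ∨ d = 1) (c : ℝ) {k : ℕ} (hk : 1 ≤ k) :
    layerInteraction (fun r : ℝ => (r ^ 2)⁻¹ ^ n) 1 c (d : ℤ) (k : ℤ) = envSum d k true n (c ^ 2) := by
  unfold layerInteraction envSum
  set g : ℤ × ℤ → ℤ × ℤ × ℤ := fun ij => ((k : ℤ), ij) with hg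
  have hinj : Function.Injective g := fun x y h => by
    simp only [hg, Prod.mk.injEq] at h; exact h.2
  have hsupp : Function.support (envTerm d k true n (c ^ 2)) ⊆ Set.range g := by
    intro v hv
    rw [Function.mem_support] at hv
    by_contra hr
    apply hv
    apply envTerm_of_not
    intro hadm
    have h1 := ((envAdm_true_iff k v).1 hadm).1
    exact hr ⟨v.2, by rw [hg]; ext <;> simp [h1]⟩
  rw [← hinj.tsum_eq hsupp]
  refine tsum_congr fun ij => ?_
  have hadm : ((k : ℕ) : ℤ) ≤ (g ij).1 ∧ (true = true → (g ij).1 ≤ (k : ℕ)) ∧ g ij ≠ 0 := by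
    refine ⟨le_rfl, fun _ => le_rfl, ?_⟩
    simp only [hg, ne_eq, Prod.mk_eq_zero, not_and, Nat.cast_eq_zero]
    intro h; omega
  rw [envTerm_of hadm, env_V_layerVec n hd]

/-- **The punctured in-layer sum is `envIn`** (any `n`: both sides vanish at the origin by definition).
[folklore] -/
theorem env_inLayerInteraction_eq (n : ℕ) :
    inLayerInteraction (fun r : ℝ => (r ^ 2)⁻¹ ^ n) 1 = envIn n := by
  unfold inLayerInteraction envIn envSum
  set g : ℤ × ℤ → ℤ × ℤ × ℤ := fun ij => ((0 : ℤ), ij) with hg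
  have hinj : Function.Injective g := fun x y h => by
    simp only [hg, Prod.mk.injEq] at h; exact h.2
  have hsupp : Function.support (envTerm 0 0 true n 0) ⊆ Set.range g := by
    intro v hv
    rw [Function.mem_support] at hv
    by_contra hr
    apply hv
    apply envTerm_of_not
    intro hadm
    have h1 := ((envAdm_true_iff 0 v).1 hadm).1
    exact hr ⟨v.2, by rw [hg]; ext <;> simp [h1]⟩
  rw [← hinj.tsum_eq hsupp]
  refine tsum_congr fun ij => ?_
  by_cases h0 : ij = 0
  · subst h0
    rw [if_pos rfl]
    exact (envTerm_of_not fun h => h.2.2 (by rw [hg]; rfl)).symm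
  · rw [if_neg h0]
    have hadm : ((0 : ℕ) : ℤ) ≤ (g ij).1 ∧ (true = true → (g ij).1 ≤ (0 : ℕ)) ∧ g ij ≠ 0 := by
      refine ⟨le_rfl, fun _ => le_rfl, ?_⟩
      simp only [hg, ne_eq, Prod.mk_eq_zero, true_and]
      exact h0
    rw [envTerm_of hadm, ← layerVec_zero_zero 1 0]
    have := env_V_layerVec n (Or.inl rfl) 0 0 ij.1 ij.2
    simp only [Nat.cast_zero] at this ⊢
    rw [this]
    simp [hg]

/-! ## The far layers -/

/-- **The far layers are an unbounded pattern sum** and the layer sums are summable in `k`: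
for `n ≥ 3`, `c > 0`, `d ∈ {0,1}`,
`∑' k, layerInteraction Vₙ 1 c d (k+3) = envSum d 3 false n (c²)`. [folklore] -/
theorem env_far_eq {n : ℕ} (hn : 3 ≤ n) {d : ℕ} (hd : d = 0 ∨ d = 1) {c : ℝ} (hc : 0 < c) :
    Summable (fun k : ℕ => layerInteraction (fun r : ℝ => (r ^ 2)⁻¹ ^ n) 1 c (d : ℤ) ((k + 3 : ℕ) : ℤ)) ∧
    ∑' k : ℕ, layerInteraction (fun r : ℝ => (r ^ 2)⁻¹ ^ n) 1 c (d : ℤ) ((k + 3 : ℕ) : ℤ) =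
      envSum d 3 false n (c ^ 2) := by
  have ht : 0 < c ^ 2 := by positivity
  have hF := envTerm_summable d 3 false hn ht
  set F := envTerm d 3 false n (c ^ 2) with hFdef
  set g : ℕ × (ℤ × ℤ) → ℤ × ℤ × ℤ := fun p => (((p.1 + 3 : ℕ) : ℤ), p.2) with hg
  have hinj : Function.Injective g := by
    rintro ⟨k, ij⟩ ⟨k', ij'⟩ h
    simp only [hg, Prod.mk.injEq] at h
    obtain ⟨h1, h2⟩ := h
    have : k = k' := by omega
    subst this; subst h2; rfl
  have hsupp : Function.support F ⊆ Set.range g := by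
    intro v hv
    rw [Function.mem_support] at hv
    by_contra hr
    apply hv
    apply envTerm_of_not
    intro hadm
    have h1 := ((envAdm_false_iff 3 v).1 hadm).1
    refine hr ⟨((v.1 - 3).toNat, v.2), ?_⟩
    rw [hg]; ext <;> simp; omega
  have hFg : Summable (F ∘ g) := hF.comp_injective hinj
  -- the fibres are the layer sums
  have hfib : ∀ k : ℕ, (fun ij : ℤ × ℤ => (F ∘ g) (k, ij)) =
      fun ij : ℤ × ℤ => (fun r : ℝ => (r ^ 2)⁻¹ ^ n) ‖layerVec 1 c (d : ℤ) ((k + 3 : ℕ) : ℤ) ij.1 ij.2‖ := by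
    intro k
    funext ij
    have hadm : ((3 : ℕ) : ℤ) ≤ (g (k, ij)).1 ∧ (false = true → (g (k, ij)).1 ≤ (3 : ℕ)) ∧ g (k, ij) ≠ 0 := by
      refine ⟨by simp [hg], fun h => Bool.noConfusion h, ?_⟩
      simp only [hg, ne_eq, Prod.mk_eq_zero, not_and, Nat.cast_eq_zero]
      intro h; omega
    show F (g (k, ij)) = _
    rw [hFdef, envTerm_of hadm, env_V_layerVec n hd]
  have hlayer : ∀ k : ℕ, ∑' ij : ℤ × ℤ, (F ∘ g) (k, ij) =
      layerInteraction (fun r : ℝ => (r ^ 2)⁻¹ ^ n) 1 c (d : ℤ) ((k + 3 : ℕ) : ℤ) := by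
    intro k
    rw [hfib k]
    rfl
  refine ⟨?_, ?_⟩
  · have := hFg.prod
    simpa only [hlayer] using this
  · calc ∑' k : ℕ, layerInteraction (fun r : ℝ => (r ^ 2)⁻¹ ^ n) 1 c (d : ℤ) ((k + 3 : ℕ) : ℤ)
        = ∑' k : ℕ, ∑' ij : ℤ × ℤ, (F ∘ g) (k, ij) := by simp only [hlayer]
      _ = ∑' p : ℕ × (ℤ × ℤ), (F ∘ g) p := hFg.tsum_prod.symm
      _ = ∑' v, F v := hinj.tsum_eq hsupp

/-- Summability of the shifted layer sums `k ↦ Φ_N(k+1)`. [folklore] -/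
theorem env_near_summable {n : ℕ} (hn : 3 ≤ n) {c : ℝ} (hc : 0 < c) :
    Summable (fun k : ℕ => layerInteraction (fun r : ℝ => (r ^ 2)⁻¹ ^ n) 1 c 1 ((k + 1 : ℕ) : ℤ)) := by
  have h := (env_far_eq hn (Or.inr rfl) hc).1
  rw [← summable_nat_add_iff 2]
  simp only [Nat.cast_one] at h
  convert h using 3

/-! ## The envelope identities -/

/-- **Twice the base energy** in pattern sums:
`2 e₀(n,c) = envIn n + 2·(layer 1) + 2·(layer 2, shifted) + 2·(layers ≥ 3, shifted)`. [folklore] -/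
theorem env_two_baseEnergy_eq {n : ℕ} (hn : 3 ≤ n) {c : ℝ} (hc : 0 < c) :
    2 * barlowBaseEnergy (fun r : ℝ => (r ^ 2)⁻¹ ^ n) 1 c =
      envIn n + 2 * envSum 1 1 true n (c ^ 2) + 2 * envSum 1 2 true n (c ^ 2) + 2 * envSum 1 3 false n (c ^ 2) := by
  unfold barlowBaseEnergy
  have hs := env_near_summable hn hc
  have hsplit := hs.sum_add_tsum_nat_add 2
  rw [Finset.sum_range_succ, Finset.sum_range_one] at hsplit
  have hfar := (env_far_eq hn (Or.inr rfl) hc).2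
  have h1 := env_layerInteraction_eq n (Or.inr rfl) c (k := 1) le_rfl
  have h2 := env_layerInteraction_eq n (Or.inr rfl) c (k := 2) (by norm_num)
  simp only [Nat.cast_one] at hfar h1 h2
  rw [env_inLayerInteraction_eq n, ← hsplit]
  have e3 : (fun i : ℕ => layerInteraction (fun r : ℝ => (r ^ 2)⁻¹ ^ n) 1 c 1 ((i + 2 + 1 : ℕ) : ℤ)) =
      fun i : ℕ => layerInteraction (fun r : ℝ => (r ^ 2)⁻¹ ^ n) 1 c 1 ((i + 3 : ℕ) : ℤ) := by
    funext i; rfl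
  rw [e3, hfar]
  have e1 : layerInteraction (fun r : ℝ => (r ^ 2)⁻¹ ^ n) 1 c 1 ((0 + 1 : ℕ) : ℤ) = envSum 1 1 true n (c ^ 2) := by
    simpa using h1
  have e2 : layerInteraction (fun r : ℝ => (r ^ 2)⁻¹ ^ n) 1 c 1 ((1 + 1 : ℕ) : ℤ) = envSum 1 2 true n (c ^ 2) := by
    simpa using h2
  rw [e1, e2]
  ring

/-- **The coupling at distance 2** in pattern sums: `J(n,c,2) = (layer 2, aligned) - (layer 2, shifted)`.
[folklore] -/
theorem env_coupling_two_eq (n : ℕ) (c : ℝ) :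
    barlowCoupling (fun r : ℝ => (r ^ 2)⁻¹ ^ n) 1 c 2 = envSum 0 2 true n (c ^ 2) - envSum 1 2 true n (c ^ 2) := by
  unfold barlowCoupling
  have h0 := env_layerInteraction_eq n (Or.inl rfl) c (k := 2) (by norm_num)
  have h1 := env_layerInteraction_eq n (Or.inr rfl) c (k := 2) (by norm_num)
  simp only [Nat.cast_zero, Nat.cast_one] at h0 h1
  rw [h0, h1]

/-- **The far couplings** in pattern sums: `∑_{k≥3} J(n,c,k) = (layers ≥ 3, aligned) - (layers ≥ 3, shifted)`.
[folklore] -/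
theorem env_far_coupling_eq {n : ℕ} (hn : 3 ≤ n) {c : ℝ} (hc : 0 < c) :
    ∑' k : ℕ, barlowCoupling (fun r : ℝ => (r ^ 2)⁻¹ ^ n) 1 c (k + 3) =
      envSum 0 3 false n (c ^ 2) - envSum 1 3 false n (c ^ 2) := by
  obtain ⟨hs0, he0⟩ := env_far_eq hn (Or.inl rfl) hc
  obtain ⟨hs1, he1⟩ := env_far_eq hn (Or.inr rfl) hc
  simp only [Nat.cast_zero, Nat.cast_one] at hs0 he0 hs1 he1
  unfold barlowCoupling
  rw [hs0.tsum_sub hs1, he0, he1]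

/-- **Upper envelope identity**: `2 e₀ + s J(2) + 2 ∑_{k≥3} J(k) = envU n (c²) s` (`n ≥ 3`, `c > 0`).
[folklore] -/
theorem env_U_eq {n : ℕ} (hn : 3 ≤ n) {c : ℝ} (hc : 0 < c) (s : ℝ) :
    2 * barlowBaseEnergy (fun r : ℝ => (r ^ 2)⁻¹ ^ n) 1 c + s * barlowCoupling (fun r : ℝ => (r ^ 2)⁻¹ ^ n) 1 c 2 +
        2 * ∑' k : ℕ, barlowCoupling (fun r : ℝ => (r ^ 2)⁻¹ ^ n) 1 c (k + 3) = envU n (c ^ 2) s := by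
  rw [env_two_baseEnergy_eq hn hc, env_coupling_two_eq, env_far_coupling_eq hn hc, envU]
  ring

/-- **Lower envelope identity**: `2 e₀ + s J(2) = envL n (c²) s` (`n ≥ 3`, `c > 0`). [folklore] -/
theorem env_L_eq {n : ℕ} (hn : 3 ≤ n) {c : ℝ} (hc : 0 < c) (s : ℝ) :
    2 * barlowBaseEnergy (fun r : ℝ => (r ^ 2)⁻¹ ^ n) 1 c + s * barlowCoupling (fun r : ℝ => (r ^ 2)⁻¹ ^ n) 1 c 2 =
      envL n (c ^ 2) s := by
  rw [env_two_baseEnergy_eq hn hc, env_coupling_two_eq, envL]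
  ring

end Summit.AtomisticToContinuum.Crystallization.Theorems.PeriodicWindowsSketch

end
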